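import Summits.QuantumFields.BalabanUV.T4Continuum.Support.ShellMeasureSeamDominated

/-!
# `T4Continuum.ShellMeasureSeamStraddlers` — SM-L6 (MR)_j FROM THE PER-STRADDLER UNION BOUND UNDER THE TERM'S MEASURE,
# AT THE LIVE LEVELS: the displayed mass ratio of the seam sockets S22 ∕ S38 PLACED as `(1 − Σ_i q_i)⁻¹` (resp. `2`)
# from DISPLAYED per-straddler large-field fractions — kernel bookkeeping, no estimate (owner audit item γ2)
(cell `pub-balaban`, sub-cell `t4`, spine estimate NE7c (node U5b); NE7c ROUND-2 crew `t4-ne7c-formalise-*`, unit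
`b2b-balaban-t4-ne7c-formalise-leaf-05` gen 8; row **S86** of the owner's table `t4/b2b-balaban-t4-ne7c-p1/LEAVES-NE7c-P1.md`
(OFFER journal l.17687, BOOKED + GO by the owner g32, RULING R-ne7cp1-g32-2: the owner audit γ2 «(MR)_j union bound per
straddler under the term's measure» DELEGATED to this row — the kernel half; the READING of the per-straddler mass stays a
displayed binder); file 1 of 2 (file 2 `ShellMeasureSeamStraddlersSync`: the S38 currency + the histories-road plug);
ADDITIVE — imports this crew's S22 `ShellMeasureSeamDominated` (leaf-01, p209577) ONLY; [folklore]; 0 `def`,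
0 `def … : Prop`, 0 sorry, 0 citation tags)

HONEST FRAMING.  Finite four-torus programme, rung (B)+1 only — NOT infinite volume, NOT a mass gap, NOT the Clay
problem, NOT summit progress; (B), `BetaPertHyp`, (B^μ) not consumed.  NE7c = `T4IndicatorShell.ShellWeightBound` is
NOT PRINTED in [Balaban 1983–89] and NOT PROVED; «NE7c ⇐ the named binders» (trigger c3).  SM-L6 = the small-field
dominance MASS RATIO (MR)_j is an ESTIMATE about Bałaban's effective measures (B15 p. 193 ∕ B16 (1.89) KIND, located,
NOT PRINTED as an instance); here it is neither asserted nor discharged: it is MOVED from ONE displayed number per level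
(the `hmass` binder of S22 `hac_dominatedLevelData` ∕ S38 `hac_dominated_slot_sync`) to finitely many DISPLAYED
PER-STRADDLER FRACTIONS `q_i` — «under the TERM's measure, straddler `i`'s co-test fails with relative mass `≤ q_i`» —
and ONE union bound, which is where the printed mechanism puts it (a BINDER `hfail`, no `def … : Prop`, trigger c2).
HONEST DEPENDENCY (cell): continuum YM on T⁴ ⇐ BetaPertH ∧ nine spine estimates (0/9 proved); BetaPertH ⇐ (D1) ∧ (D4) ∧
CAP+tail; G-an2-4 gates asym, D1 and NE2/3/4.

THE AUDIT POINT (γ2), made literal in the binder types.  At a live slot the run's ACTUAL realized slot measure is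
`μ = ν.withDensity (F′ · 1[⋂_{i∈I} Pass i])` (reading (R): the slot's own indicator removed; the STRADDLING neighbours'
small-field co-tests `1[Pass i]` still inside), END-II (S76 ∕ S80 at live levels, the level-0 faces at `j = 0`) delivers
(M1) for THE TERM's MEASURE `μ′ = ν.withDensity F′` (the same sectioned density with the straddling co-tests DROPPED,
kept co-tests `Jco` inside), and the union bound that converts per-straddler failure fractions into the mass ratio
`μ′ univ ≤ M · μ univ` consumes fractions OF `μ′` — `μ′((Pass i)ᶜ) ≤ q_i · μ′(univ)` — NOT of the bare level-`j` field
law `ν = fieldMeasure P j SU2` and NOT of `μ`.  With HETEROGENEOUS fractions (`q_i` may depend on the straddler's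
position and level) and `Σ_{i∈I} q_i ≤ a < 1` the ratio is `M = (1 − a)⁻¹` (§1); the tree's uniform-fraction lemma
`T4ShellMeasureLocal.measure_univ_le_two_mul_of_unionBound` (`#I·q ≤ ½ ⟹ M = 2`, consumed at level 0 by S2
`ShellMeasureWilsonStraddle.slotAntiConcentration_withDensity_drop_two`) is the instance `a = ½`.

## What is proved ([folklore] bookkeeping)
* §1 ONE finite law: `measure_univ_le_of_unionBound_frac` (`μ′ univ ≤ ofReal((1−a)⁻¹)·μ′(⋂ Pass)`), `…_two`,
  `hmass_of_unionBound_frac` (+ `μ′(⋂ Pass) ≤ m` ⟹ the DISPLAYED-RATIO SHAPE `μ′ univ ≤ ofReal((1−a)⁻¹)·m` of S22∕S38).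
* §2 term's measure vs actual slot measure (`withDensity`): `withDensity_mulIndicator_univ`∕`_le`,
  `lintegral_mulIndicator_ne_top`, `slotAC_of_unionBound_frac` ((M1) for `μ′` with `D` ⟹ (M1) for `μ` with `D·(1−a)⁻¹`).
* §3 slot families, S7a∕S22 currency (`θ (lvl K s)`): `hac_straddlers_slot`∕`_level` = S22 `hac_dominated_slot`∕`_level`
  with `hS`∕`hmass` DISCHARGED from the per-straddler data.
* §4 the realized `SU(2)` family: `hac_straddlersLevelData` (conclusion LITERALLY the seam S13
  `ShellMeasureRootCompositionSeam.shellWeightBound_of_levelDataSU2`'s `hacX` for `FX := F′X · 1[⋂ Pass]`,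
  `DslotX := Dslot · (1 − a_{lvl})⁻¹`), `…_level`, and THE WALL's COUNT FORMS `hac_straddlersLevelData_count` (uniform
  level fraction `q_j`, displayed K-free count `#I ≤ Nstr`, `Nstr·q_j < 1` ⟹ `Dslot·(1 − Nstr·q_j)⁻¹` — the owner's
  acceptance shape) and `…_count_two` (`Nstr·q_j ≤ ½` ⟹ `Dslot·2`).
* file 2 `ShellMeasureSeamStraddlersSync`: the S38 currency (thresholds BY SLOT) and the END-of-record plug.

WHAT THIS DOES NOT DO.  No per-straddler fraction, no count, no (M1) is PROVED for any of Bałaban's measures; END-I's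
window ∕ closeness ∕ rate binders untouched; NOTHING in the countdown moves; NE7c NOT proved; spine PROVED 0/9.
-/

noncomputable section

open MeasureTheory Finset
open scoped ENNReal

namespace Summit.QuantumFields.BalabanUV.T4Continuum.ShellMeasureSeamStraddlers

open Literature.MathematicalPhysics.QuantumFieldTheory.Balaban1983to89
open T4ShellMeasure (SlotAntiConcentration)
open T4ShellMeasureFibre (slotAntiConcentration_of_dominated)
open T4CubeChartGnomonic (SU2)
open ShellMeasureSeamDominated (hac_dominated_slot hac_dominated_level withDensity_apply_le_of_le)

/-! ## §1 One finite law: the union bound with heterogeneous per-straddler fractions -/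

section OneLaw

variable {Ω : Type*} [MeasurableSpace Ω]

/-- **THE UNION BOUND WITH HETEROGENEOUS FRACTIONS.**  A finite law `μ′`, finitely many straddlers `i ∈ I` with pass
events `Pass i`, each FAILING with relative `μ′`-mass `≤ q i` (`0 ≤ q i`), and `Σ_{i∈I} q i ≤ a < 1` ⟹
`μ′(everything) ≤ (1 − a)⁻¹ · μ′(⋂_{i∈I} Pass i)`.  (The tree's
`T4ShellMeasureLocal.measure_univ_le_two_mul_of_unionBound` is the uniform instance `q i ≡ q`, `#I·q ≤ ½`.) [folklore] -/
theorem measure_univ_le_of_unionBound_frac (μ' : Measure Ω) [IsFiniteMeasure μ'] {κ : Type*} (I : Finset κ)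
    (Pass : κ → Set Ω) (q : κ → ℝ) (hq : ∀ i ∈ I, 0 ≤ q i)
    (hfail : ∀ i ∈ I, μ' (Pass i)ᶜ ≤ ENNReal.ofReal (q i) * μ' Set.univ) {a : ℝ} (ha : ∑ i ∈ I, q i ≤ a)
    (ha1 : a < 1) :
    μ' Set.univ ≤ ENNReal.ofReal (1 / (1 - a)) * μ' (⋂ i ∈ I, Pass i) := by
  have ha0 : 0 ≤ a := (Finset.sum_nonneg hq).trans ha
  set m := μ' Set.univ with hm
  set Pm := μ' (⋂ i ∈ I, Pass i) with hPm
  have hU : μ' (⋃ i ∈ I, (Pass i)ᶜ) ≤ ENNReal.ofReal a * m := by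
    calc μ' (⋃ i ∈ I, (Pass i)ᶜ) ≤ ∑ i ∈ I, μ' (Pass i)ᶜ := measure_biUnion_finset_le I _
      _ ≤ ∑ i ∈ I, ENNReal.ofReal (q i) * m := Finset.sum_le_sum fun i hi => hfail i hi
      _ = ENNReal.ofReal (∑ i ∈ I, q i) * m := by
          rw [ENNReal.ofReal_sum_of_nonneg hq, Finset.sum_mul]
      _ ≤ ENNReal.ofReal a * m := mul_le_mul_of_nonneg_right (ENNReal.ofReal_le_ofReal ha) bot_le
  have hcompl : (⋃ i ∈ I, (Pass i)ᶜ)ᶜ = ⋂ i ∈ I, Pass i := by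
    rw [Set.compl_iUnion₂]; simp only [compl_compl]
  have hsplit : m ≤ ENNReal.ofReal a * m + Pm := by
    calc m = μ' ((⋃ i ∈ I, (Pass i)ᶜ) ∪ (⋃ i ∈ I, (Pass i)ᶜ)ᶜ) := by rw [Set.union_compl_self]
      _ ≤ μ' (⋃ i ∈ I, (Pass i)ᶜ) + μ' (⋃ i ∈ I, (Pass i)ᶜ)ᶜ := measure_union_le _ _
      _ ≤ ENNReal.ofReal a * m + Pm := by rw [hcompl]; exact add_le_add hU le_rfl
  have hm_ne : m ≠ ∞ := measure_ne_top μ' _; have hPm_ne : Pm ≠ ∞ := measure_ne_top μ' _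
  have ham_ne : ENNReal.ofReal a * m ≠ ∞ := ENNReal.mul_ne_top ENNReal.ofReal_ne_top hm_ne
  have hreal : m.toReal ≤ a * m.toReal + Pm.toReal := by
    have h := ENNReal.toReal_mono (ENNReal.add_ne_top.2 ⟨ham_ne, hPm_ne⟩) hsplit
    rwa [ENNReal.toReal_add ham_ne hPm_ne, ENNReal.toReal_mul, ENNReal.toReal_ofReal ha0] at h
  have hreal' : m.toReal ≤ 1 / (1 - a) * Pm.toReal := by
    rw [one_div, ← div_eq_inv_mul, le_div_iff₀ (sub_pos.2 ha1)]; nlinarith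
  calc m = ENNReal.ofReal m.toReal := (ENNReal.ofReal_toReal hm_ne).symm
    _ ≤ ENNReal.ofReal (1 / (1 - a) * Pm.toReal) := ENNReal.ofReal_le_ofReal hreal'
    _ = ENNReal.ofReal (1 / (1 - a)) * Pm := by
        rw [ENNReal.ofReal_mul (by positivity), ENNReal.ofReal_toReal hPm_ne]

/-- **… THE RATIO `2`** (`Σ_{i∈I} q i ≤ ½`). [folklore] -/
theorem measure_univ_le_two_of_unionBound_frac (μ' : Measure Ω) [IsFiniteMeasure μ'] {κ : Type*} (I : Finset κ)
    (Pass : κ → Set Ω) (q : κ → ℝ) (hq : ∀ i ∈ I, 0 ≤ q i)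
    (hfail : ∀ i ∈ I, μ' (Pass i)ᶜ ≤ ENNReal.ofReal (q i) * μ' Set.univ) (hhalf : ∑ i ∈ I, q i ≤ 1 / 2) :
    μ' Set.univ ≤ ENNReal.ofReal 2 * μ' (⋂ i ∈ I, Pass i) := by
  have h := measure_univ_le_of_unionBound_frac μ' I Pass q hq hfail hhalf (by norm_num)
  rwa [show (1 : ℝ) / (1 - 1 / 2) = 2 by norm_num] at h

/-- **THE DISPLAYED-RATIO SHAPE of S22 ∕ S38.**  The same PLUS `μ′(⋂_{i∈I} Pass i) ≤ m` (e.g. `m = μ univ` for the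
actual slot measure `μ`, or the total mass of a partial law) ⟹ `μ′ univ ≤ ofReal((1 − a)⁻¹) · m` — the `hmass` binder
of `ShellMeasureSeamDominated.hac_dominated_slot` ∕ `ShellMeasureSeamDominatedSync.hac_dominated_slot_sync` with
`M := 1 ∕ (1 − a)`. [folklore] -/
theorem hmass_of_unionBound_frac (μ' : Measure Ω) [IsFiniteMeasure μ'] {κ : Type*} (I : Finset κ)
    (Pass : κ → Set Ω) (q : κ → ℝ) (hq : ∀ i ∈ I, 0 ≤ q i)
    (hfail : ∀ i ∈ I, μ' (Pass i)ᶜ ≤ ENNReal.ofReal (q i) * μ' Set.univ) {a : ℝ} (ha : ∑ i ∈ I, q i ≤ a)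
    (ha1 : a < 1) {m : ℝ≥0∞} (hsub : μ' (⋂ i ∈ I, Pass i) ≤ m) :
    μ' Set.univ ≤ ENNReal.ofReal (1 / (1 - a)) * m :=
  (measure_univ_le_of_unionBound_frac μ' I Pass q hq hfail ha ha1).trans
    (mul_le_mul_of_nonneg_left hsub bot_le)

end OneLaw

/-! ## §2 The term's measure `ν.withDensity F′` and the actual slot measure `ν.withDensity (F′ · 1[⋂ Pass])` -/

section Density

variable {Ω : Type*} [MeasurableSpace Ω] (ν : Measure Ω)

omit [MeasurableSpace Ω] in
/-- `F x · 1_E x = 1_E F x`. [folklore] -/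
theorem mul_indicator_one_eq (F : Ω → ℝ≥0∞) (E : Set Ω) (x : Ω) : F x * E.indicator 1 x = E.indicator F x := by
  by_cases hx : x ∈ E <;> simp [hx]

/-- **`μ univ = μ′(E)`**: the actual slot measure's total mass is the term's measure of the pass event. [folklore] -/
theorem withDensity_mulIndicator_univ (F : Ω → ℝ≥0∞) {E : Set Ω} (hE : MeasurableSet E) :
    ν.withDensity (fun x => F x * E.indicator 1 x) Set.univ = ν.withDensity F E := by
  rw [withDensity_apply _ MeasurableSet.univ, Measure.restrict_univ, withDensity_apply _ hE,
    show (fun x => F x * E.indicator 1 x) = E.indicator F from funext (mul_indicator_one_eq F E),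
    lintegral_indicator hE]

/-- re-inserting the straddling co-tests only LOSES mass, on every set (shell domination). [folklore] -/
theorem withDensity_mulIndicator_le (F : Ω → ℝ≥0∞) (E A : Set Ω) :
    ν.withDensity (fun x => F x * E.indicator 1 x) A ≤ ν.withDensity F A :=
  withDensity_apply_le_of_le ν (fun x => by
    rw [mul_indicator_one_eq]; exact Set.indicator_le_self _ _ x) A

/-- finiteness passes to the actual density: `∫⁻ F·1_E ≤ ∫⁻ F ≠ ∞` (the seam's `hFfinX` for the actual density from
that of the term's density). [folklore] -/
theorem lintegral_mulIndicator_ne_top (F : Ω → ℝ≥0∞) (E : Set Ω) (hF : ∫⁻ x, F x ∂ν ≠ ∞) :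
    ∫⁻ x, F x * E.indicator 1 x ∂ν ≠ ∞ :=
  ne_top_of_le_ne_top hF (lintegral_mono fun x => by
    rw [mul_indicator_one_eq]; exact Set.indicator_le_self _ _ x)

/-- **(M1) FOR THE ACTUAL SLOT MEASURE FROM (M1) FOR THE TERM'S MEASURE + THE PER-STRADDLER UNION BOUND.**  If the
term's measure `μ′ = ν.withDensity F′` (finite) satisfies `SlotAntiConcentration … u θ ρ D` (END-II's output), the
straddlers' pass events `Pass i`, `i ∈ I`, are measurable, each FAILS with relative `μ′`-mass `≤ q i`, and
`Σ_{i∈I} q i ≤ a < 1`, then the ACTUAL slot measure `μ = ν.withDensity (F′ · 1[⋂_{i∈I} Pass i])` satisfies (M1) for the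
same `u, θ, ρ` with constant `D · (1 − a)⁻¹` (`T4ShellMeasureFibre.slotAntiConcentration_of_dominated`).  The fractions
are fractions OF `μ′` (the audit point).  CONDITIONAL; nothing printed asserted. [folklore] -/
theorem slotAC_of_unionBound_frac {F' : Ω → ℝ≥0∞} (hfin : ∫⁻ x, F' x ∂ν ≠ ∞) {u : Ω → ℝ} {θ ρ D : ℝ}
    (hD : 0 ≤ D) (hρ : 0 ≤ ρ) (h : SlotAntiConcentration (ν.withDensity F') u θ ρ D) {κ : Type*} (I : Finset κ)
    {Pass : κ → Set Ω} (hPass : ∀ i ∈ I, MeasurableSet (Pass i)) {q : κ → ℝ} (hq : ∀ i ∈ I, 0 ≤ q i)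
    (hfail : ∀ i ∈ I, ν.withDensity F' (Pass i)ᶜ ≤ ENNReal.ofReal (q i) * ν.withDensity F' Set.univ) {a : ℝ}
    (ha : ∑ i ∈ I, q i ≤ a) (ha1 : a < 1) :
    SlotAntiConcentration (ν.withDensity fun x => F' x * (⋂ i ∈ I, Pass i).indicator 1 x) u θ ρ
      (D * (1 / (1 - a))) := by
  haveI : IsFiniteMeasure (ν.withDensity F') := isFiniteMeasure_withDensity hfin
  refine slotAntiConcentration_of_dominated hD hρ (withDensity_mulIndicator_le ν F' _ _) h ?_
  rw [withDensity_mulIndicator_univ ν F' (Finset.measurableSet_biInter I hPass)]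
  exact measure_univ_le_of_unionBound_frac _ I Pass q hq hfail ha ha1

end Density

/-! ## §3 Slot families, S7a∕S22 currency: thresholds, widths, constants by LEVEL -/

section Families

variable {σ κ : Type*} {Ω : ℕ → σ → Type*} [∀ K s, MeasurableSpace (Ω K s)] {l₀ : ℝ} {S : ℕ → Finset σ}
  {lvl : ℕ → σ → ℕ} {ν : ∀ K : ℕ, ℝ → ∀ s : σ, Measure (Ω K s)} {F' : ∀ K : ℕ, ℝ → ∀ s : σ, Ω K s → ℝ≥0∞}
  {u : ∀ K : ℕ, ℝ → ∀ s : σ, Ω K s → ℝ} {θ D ρ a : ℕ → ℝ} {Dslot : ℕ → ℝ → σ → ℝ}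
  {I : ℕ → ℝ → σ → Finset κ} {Pass : ∀ K : ℕ, ℝ → ∀ s : σ, κ → Set (Ω K s)} {q : ℕ → ℝ → σ → κ → ℝ}

/-- **SM-L6 PER SLOT FROM THE PER-STRADDLER UNION BOUND (slot-constant form).**  Per comparison index `K`, source
`|t| ≤ l₀`, slot `s ∈ S K`: the TERM's measure `(ν K t s).withDensity (F′ K t s)` is finite (`hfin`) and carries (M1) at
level data `θ∕ρ (lvl K s)` with slot constant `Dslot K t s ≥ 0` (`hac'` — END-II's output); the slot's straddlers
`i ∈ I K t s` have measurable pass events, DISPLAYED failure fractions `0 ≤ q K t s i` UNDER THE TERM's MEASURE (`hfail`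
— SM-L6 (MR)_j, located, asserted by nobody), `Σ_{i∈I K t s} q K t s i ≤ a (lvl K s) < 1` ⟹ (M1) for the ACTUAL slot
measure `(ν K t s).withDensity (F′ K t s · 1[⋂_i Pass K t s i])`, slot constant `Dslot K t s · (1 − a (lvl K s))⁻¹`
(S22 `hac_dominated_slot`'s conclusion shape, its `hS`∕`hmass` DISCHARGED). [folklore] -/
theorem hac_straddlers_slot (hρ : ∀ j, 0 ≤ ρ j) (hDslot0 : ∀ K t, |t| ≤ l₀ → ∀ s ∈ S K, 0 ≤ Dslot K t s)
    (hfin : ∀ K t s, ∫⁻ x, F' K t s x ∂(ν K t s) ≠ ∞)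
    (hPass : ∀ K t s, ∀ i ∈ I K t s, MeasurableSet (Pass K t s i))
    (hq : ∀ K t s, ∀ i ∈ I K t s, 0 ≤ q K t s i)
    (hfail : ∀ K t, |t| ≤ l₀ → ∀ s ∈ S K, ∀ i ∈ I K t s,
      (ν K t s).withDensity (F' K t s) (Pass K t s i)ᶜ ≤
        ENNReal.ofReal (q K t s i) * (ν K t s).withDensity (F' K t s) Set.univ)
    (hsum : ∀ K t, |t| ≤ l₀ → ∀ s ∈ S K, ∑ i ∈ I K t s, q K t s i ≤ a (lvl K s)) (ha1 : ∀ j, a j < 1)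
    (hac' : ∀ K t, |t| ≤ l₀ → ∀ s ∈ S K,
      SlotAntiConcentration ((ν K t s).withDensity (F' K t s)) (u K t s) (θ (lvl K s)) (ρ (lvl K s))
        (Dslot K t s)) :
    ∀ K t, |t| ≤ l₀ → ∀ s ∈ S K,
      SlotAntiConcentration
        ((ν K t s).withDensity fun x => F' K t s x * (⋂ i ∈ I K t s, Pass K t s i).indicator 1 x)
        (u K t s) (θ (lvl K s)) (ρ (lvl K s)) (Dslot K t s * (1 / (1 - a (lvl K s)))) :=
  fun K t ht s hs => slotAC_of_unionBound_frac (ν K t s) (hfin K t s) (hDslot0 K t ht s hs) (hρ _)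
    (hac' K t ht s hs) (I K t s) (hPass K t s) (hq K t s) (hfail K t ht s hs) (hsum K t ht s hs) (ha1 _)

/-- **… LEVEL-CONSTANT FORM (END-I's `hac` VERBATIM).**  The same PLUS the displayed level majorant
`Dslot K t s · (1 − a (lvl K s))⁻¹ ≤ D (lvl K s)` ⟹ END-I's wall binder with constants by level
(`ShellMeasureRootCompositionSeam.hac_of_slotConst` through S22 `hac_dominated_level`'s road). [folklore] -/
theorem hac_straddlers_level (hρ : ∀ j, 0 ≤ ρ j) (hDslot0 : ∀ K t, |t| ≤ l₀ → ∀ s ∈ S K, 0 ≤ Dslot K t s)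
    (hfin : ∀ K t s, ∫⁻ x, F' K t s x ∂(ν K t s) ≠ ∞)
    (hPass : ∀ K t s, ∀ i ∈ I K t s, MeasurableSet (Pass K t s i))
    (hq : ∀ K t s, ∀ i ∈ I K t s, 0 ≤ q K t s i)
    (hfail : ∀ K t, |t| ≤ l₀ → ∀ s ∈ S K, ∀ i ∈ I K t s,
      (ν K t s).withDensity (F' K t s) (Pass K t s i)ᶜ ≤
        ENNReal.ofReal (q K t s i) * (ν K t s).withDensity (F' K t s) Set.univ)
    (hsum : ∀ K t, |t| ≤ l₀ → ∀ s ∈ S K, ∑ i ∈ I K t s, q K t s i ≤ a (lvl K s)) (ha1 : ∀ j, a j < 1)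
    (hDM : ∀ K t, |t| ≤ l₀ → ∀ s ∈ S K, Dslot K t s * (1 / (1 - a (lvl K s))) ≤ D (lvl K s))
    (hac' : ∀ K t, |t| ≤ l₀ → ∀ s ∈ S K,
      SlotAntiConcentration ((ν K t s).withDensity (F' K t s)) (u K t s) (θ (lvl K s)) (ρ (lvl K s))
        (Dslot K t s)) :
    ∀ K t, |t| ≤ l₀ → ∀ s ∈ S K,
      SlotAntiConcentration
        ((ν K t s).withDensity fun x => F' K t s x * (⋂ i ∈ I K t s, Pass K t s i).indicator 1 x)
        (u K t s) (θ (lvl K s)) (ρ (lvl K s)) (D (lvl K s)) :=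
  ShellMeasureRootCompositionSeam.hac_of_slotConst
    (μ := fun K t s => (ν K t s).withDensity fun x => F' K t s x * (⋂ i ∈ I K t s, Pass K t s i).indicator 1 x)
    (Dslot := fun K t s => Dslot K t s * (1 / (1 - a (lvl K s)))) hρ hDM
    (hac_straddlers_slot hρ hDslot0 hfin hPass hq hfail hsum ha1 hac')

end Families

/-! ## §4 The realized `SU(2)` slot family: the seam's `hacX` with the straddling co-tests IN -/

section Realized

variable {σ κ : Type*} {P : Params} {l₀ : ℝ} {S : ℕ → Finset σ} {lvl : ℕ → σ → ℕ}
  {F' : ∀ K : ℕ, ℝ → ∀ s : σ, GaugeField P (lvl K s) SU2 → ℝ≥0∞}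
  {u : ∀ K : ℕ, ℝ → ∀ s : σ, GaugeField P (lvl K s) SU2 → ℝ} {θ D ρ a q₁ : ℕ → ℝ} {Dslot : ℕ → ℝ → σ → ℝ}
  {I : ℕ → ℝ → σ → Finset κ} {Pass : ∀ K : ℕ, ℝ → ∀ s : σ, κ → Set (GaugeField P (lvl K s) SU2)}
  {q : ℕ → ℝ → σ → κ → ℝ} {Nstr : ℝ}

/-- **SM-L6 (MR)_j FROM THE PER-STRADDLER UNION BOUND, REALIZED `SU(2)` FAMILY — the seam END's `hacX` (slot-constant
form).**  Per slot `s ∈ S K` at level `j = lvl K s`, source `|t| ≤ l₀`: THE TERM's DENSITY `F′ K t s` on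
`GaugeField P j SU2` (own indicator removed, straddling co-tests DROPPED, kept co-tests and the sectioned weight inside —
END-II's admissible shape), integrable (`hfin`), with (M1) for `(fieldMeasure P j SU2).withDensity (F′ K t s)`, slot
constant `Dslot K t s ≥ 0` (`hac'` — END-II's OUTPUT: S76∕S80 at live levels, the level-0 faces at `j = 0`); straddlers
`i ∈ I K t s` (neighbouring cubes whose small-field tests meet the block) with measurable pass events and DISPLAYED
failure fractions `q K t s i ≥ 0` UNDER THE TERM's MEASURE (`hfail`: (MR)_j — small-field dominance, B15 p. 193 ∕ B16
(1.89) KIND, located, NOT PRINTED as an instance, asserted by nobody), `Σ_i q K t s i ≤ a_j < 1` ⟹ (M1) for the ACTUAL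
slot measure `(fieldMeasure P j SU2).withDensity (F′ K t s · 1[⋂_i Pass K t s i])`, slot constant `Dslot K t s · (1 − a_j)⁻¹`
— the `hacX` of `ShellMeasureRootCompositionSeam.shellWeightBound_of_levelDataSU2` (its `hFfinX` for this density:
`lintegral_mulIndicator_ne_top`).  CONDITIONAL on every binder. [folklore] -/
theorem hac_straddlersLevelData (hρ : ∀ j, 0 ≤ ρ j) (hDslot0 : ∀ K t, |t| ≤ l₀ → ∀ s ∈ S K, 0 ≤ Dslot K t s)
    (hfin : ∀ K t s, ∫⁻ U, F' K t s U ∂(fieldMeasure P (lvl K s) SU2) ≠ ∞)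
    (hPass : ∀ K t s, ∀ i ∈ I K t s, MeasurableSet (Pass K t s i))
    (hq : ∀ K t s, ∀ i ∈ I K t s, 0 ≤ q K t s i)
    (hfail : ∀ K t, |t| ≤ l₀ → ∀ s ∈ S K, ∀ i ∈ I K t s,
      ((fieldMeasure P (lvl K s) SU2).withDensity (F' K t s)) (Pass K t s i)ᶜ ≤
        ENNReal.ofReal (q K t s i) * ((fieldMeasure P (lvl K s) SU2).withDensity (F' K t s)) Set.univ)
    (hsum : ∀ K t, |t| ≤ l₀ → ∀ s ∈ S K, ∑ i ∈ I K t s, q K t s i ≤ a (lvl K s)) (ha1 : ∀ j, a j < 1)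
    (hac' : ∀ K t, |t| ≤ l₀ → ∀ s ∈ S K,
      SlotAntiConcentration ((fieldMeasure P (lvl K s) SU2).withDensity (F' K t s)) (u K t s)
        (θ (lvl K s)) (ρ (lvl K s)) (Dslot K t s)) :
    ∀ K t, |t| ≤ l₀ → ∀ s ∈ S K,
      SlotAntiConcentration
        ((fieldMeasure P (lvl K s) SU2).withDensity fun U =>
          F' K t s U * (⋂ i ∈ I K t s, Pass K t s i).indicator 1 U)
        (u K t s) (θ (lvl K s)) (ρ (lvl K s)) (Dslot K t s * (1 / (1 - a (lvl K s)))) :=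
  hac_straddlers_slot (ν := fun K _ s => fieldMeasure P (lvl K s) SU2) hρ hDslot0 hfin hPass hq hfail hsum ha1 hac'

/-- **… LEVEL-CONSTANT FORM (END-I's `hac` VERBATIM for the realized family)**: PLUS the displayed level majorant
`Dslot K t s · (1 − a_j)⁻¹ ≤ D j`. [folklore] -/
theorem hac_straddlersLevelData_level (hρ : ∀ j, 0 ≤ ρ j)
    (hDslot0 : ∀ K t, |t| ≤ l₀ → ∀ s ∈ S K, 0 ≤ Dslot K t s)
    (hfin : ∀ K t s, ∫⁻ U, F' K t s U ∂(fieldMeasure P (lvl K s) SU2) ≠ ∞)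
    (hPass : ∀ K t s, ∀ i ∈ I K t s, MeasurableSet (Pass K t s i))
    (hq : ∀ K t s, ∀ i ∈ I K t s, 0 ≤ q K t s i)
    (hfail : ∀ K t, |t| ≤ l₀ → ∀ s ∈ S K, ∀ i ∈ I K t s,
      ((fieldMeasure P (lvl K s) SU2).withDensity (F' K t s)) (Pass K t s i)ᶜ ≤
        ENNReal.ofReal (q K t s i) * ((fieldMeasure P (lvl K s) SU2).withDensity (F' K t s)) Set.univ)
    (hsum : ∀ K t, |t| ≤ l₀ → ∀ s ∈ S K, ∑ i ∈ I K t s, q K t s i ≤ a (lvl K s)) (ha1 : ∀ j, a j < 1)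
    (hDM : ∀ K t, |t| ≤ l₀ → ∀ s ∈ S K, Dslot K t s * (1 / (1 - a (lvl K s))) ≤ D (lvl K s))
    (hac' : ∀ K t, |t| ≤ l₀ → ∀ s ∈ S K,
      SlotAntiConcentration ((fieldMeasure P (lvl K s) SU2).withDensity (F' K t s)) (u K t s)
        (θ (lvl K s)) (ρ (lvl K s)) (Dslot K t s)) :
    ∀ K t, |t| ≤ l₀ → ∀ s ∈ S K,
      SlotAntiConcentration
        ((fieldMeasure P (lvl K s) SU2).withDensity fun U =>
          F' K t s U * (⋂ i ∈ I K t s, Pass K t s i).indicator 1 U)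
        (u K t s) (θ (lvl K s)) (ρ (lvl K s)) (D (lvl K s)) :=
  hac_straddlers_level (ν := fun K _ s => fieldMeasure P (lvl K s) SU2) hρ hDslot0 hfin hPass hq hfail hsum ha1
    hDM hac'

/-- **THE WALL's COUNT FORM (v2.2 §2b row `Jco`: «union bound over ≤ 9⁴N₁ straddlers × large-field small factor»;
the owner's acceptance shape for row S86).**  A level-indexed fraction `q₁ j ≥ 0` UNIFORM over the slot's straddlers
(under the term's measure), a DISPLAYED K-free count `#I K t s ≤ Nstr` (block geometry, reading [R]) and
`Nstr · q₁ j < 1` ⟹ the seam's `hacX` for the actual slot measures with slot constants `Dslot K t s · (1 − Nstr·q₁ j)⁻¹`.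
CONDITIONAL; the fraction and the count are DISPLAYED, not discharged. [folklore] -/
theorem hac_straddlersLevelData_count (hρ : ∀ j, 0 ≤ ρ j)
    (hDslot0 : ∀ K t, |t| ≤ l₀ → ∀ s ∈ S K, 0 ≤ Dslot K t s)
    (hfin : ∀ K t s, ∫⁻ U, F' K t s U ∂(fieldMeasure P (lvl K s) SU2) ≠ ∞)
    (hPass : ∀ K t s, ∀ i ∈ I K t s, MeasurableSet (Pass K t s i)) (hq₁ : ∀ j, 0 ≤ q₁ j)
    (hfail : ∀ K t, |t| ≤ l₀ → ∀ s ∈ S K, ∀ i ∈ I K t s,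
      ((fieldMeasure P (lvl K s) SU2).withDensity (F' K t s)) (Pass K t s i)ᶜ ≤
        ENNReal.ofReal (q₁ (lvl K s)) * ((fieldMeasure P (lvl K s) SU2).withDensity (F' K t s)) Set.univ)
    (hcount : ∀ K t, |t| ≤ l₀ → ∀ s ∈ S K, ((I K t s).card : ℝ) ≤ Nstr) (hN : ∀ j, Nstr * q₁ j < 1)
    (hac' : ∀ K t, |t| ≤ l₀ → ∀ s ∈ S K,
      SlotAntiConcentration ((fieldMeasure P (lvl K s) SU2).withDensity (F' K t s)) (u K t s)
        (θ (lvl K s)) (ρ (lvl K s)) (Dslot K t s)) :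
    ∀ K t, |t| ≤ l₀ → ∀ s ∈ S K,
      SlotAntiConcentration
        ((fieldMeasure P (lvl K s) SU2).withDensity fun U =>
          F' K t s U * (⋂ i ∈ I K t s, Pass K t s i).indicator 1 U)
        (u K t s) (θ (lvl K s)) (ρ (lvl K s)) (Dslot K t s * (1 / (1 - Nstr * q₁ (lvl K s)))) :=
  hac_straddlersLevelData (q := fun K _ s _ => q₁ (lvl K s)) (a := fun j => Nstr * q₁ j) hρ hDslot0 hfin hPass
    (fun K t s _ _ => hq₁ _) hfail
    (fun K t ht s hs => by
      rw [Finset.sum_const, nsmul_eq_mul]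
      exact mul_le_mul_of_nonneg_right (hcount K t ht s hs) (hq₁ _)) hN hac'

/-- **… RATIO `2`**: the same with `Nstr · q₁ j ≤ ½` ⟹ slot constants `Dslot K t s · 2`. [folklore] -/
theorem hac_straddlersLevelData_count_two (hρ : ∀ j, 0 ≤ ρ j)
    (hDslot0 : ∀ K t, |t| ≤ l₀ → ∀ s ∈ S K, 0 ≤ Dslot K t s)
    (hfin : ∀ K t s, ∫⁻ U, F' K t s U ∂(fieldMeasure P (lvl K s) SU2) ≠ ∞)
    (hPass : ∀ K t s, ∀ i ∈ I K t s, MeasurableSet (Pass K t s i)) (hq₁ : ∀ j, 0 ≤ q₁ j)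
    (hfail : ∀ K t, |t| ≤ l₀ → ∀ s ∈ S K, ∀ i ∈ I K t s,
      ((fieldMeasure P (lvl K s) SU2).withDensity (F' K t s)) (Pass K t s i)ᶜ ≤
        ENNReal.ofReal (q₁ (lvl K s)) * ((fieldMeasure P (lvl K s) SU2).withDensity (F' K t s)) Set.univ)
    (hcount : ∀ K t, |t| ≤ l₀ → ∀ s ∈ S K, ((I K t s).card : ℝ) ≤ Nstr) (hN : ∀ j, Nstr * q₁ j ≤ 1 / 2)
    (hac' : ∀ K t, |t| ≤ l₀ → ∀ s ∈ S K,
      SlotAntiConcentration ((fieldMeasure P (lvl K s) SU2).withDensity (F' K t s)) (u K t s)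
        (θ (lvl K s)) (ρ (lvl K s)) (Dslot K t s)) :
    ∀ K t, |t| ≤ l₀ → ∀ s ∈ S K,
      SlotAntiConcentration
        ((fieldMeasure P (lvl K s) SU2).withDensity fun U =>
          F' K t s U * (⋂ i ∈ I K t s, Pass K t s i).indicator 1 U)
        (u K t s) (θ (lvl K s)) (ρ (lvl K s)) (Dslot K t s * 2) := by
  intro K t ht s hs
  have h := hac_straddlersLevelData (q := fun K _ s _ => q₁ (lvl K s)) (a := fun _ => 1 / 2) hρ hDslot0 hfin hPass
    (fun K t s _ _ => hq₁ _) hfail (fun K t ht s hs => ?_) (fun _ => by norm_num) hac' K t ht s hs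
  · rwa [show (1 : ℝ) / (1 - 1 / 2) = 2 by norm_num] at h
  · rw [Finset.sum_const, nsmul_eq_mul]
    exact (mul_le_mul_of_nonneg_right (hcount K t ht s hs) (hq₁ _)).trans (hN _)

end Realized


end Summit.QuantumFields.BalabanUV.T4Continuum.ShellMeasureSeamStraddlers

end
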